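import Summits.Parity.GeneralizedHardyLittlewood.Theorems.LeeYangFibresRelativeDimOneTypeDefs
import Summits.Parity.GeneralizedHardyLittlewood.Theorems.LeeYangFibresRelativeDimOneSplitDictionary
import Summits.Parity.GeneralizedHardyLittlewood.Theorems.LeeYangFibresRelativeDimOneSplitTranslation
import Summits.Parity.GeneralizedHardyLittlewood.Theorems.LeeYangFibresRelativeDimOneSplitCosetMean
import HarnessLib

/-!
# Type data for the reshaped line `gallagher-backwards-split` (crux stmt-Parity-14113
`LeeYangFibres.RelativeDimOne`, stub `stub_typeData`), PART A: residues, cells, the prime side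

Infrastructure for `stub_typeData : TypeClassMoments θ₁ → SingularWeightFacts → TypeRigidity → TypeData θ`
(vocabulary in `LeeYangFibresRelativeDimOneTypeDefs`):

* incidence types modulo `q` only see the shifts modulo `q` (`incType_congr_mod`), so a type-invariant spectrum
  is `q`-periodic at a squarefree modulus `q` (`typeInvariant_periodic`);
* the residue vector `(b_i mod q)_i ∈ [0, q)^t` of an integer shift vector and the type cell
  `{b : ∀ p ∈ P.primeFactors, incType p a b = incType p a b₀}` of the target `b₀` with its residue description
  `typeCell P P a b₀` (`mem_typeCell_self_iff`, `natVec_mem_typeCell`);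
* the decomposition of a sum over the shifts of a box in the cell into the residue classes of the cell
  (`sum_filter_isCell_eq`) and, with the landed `dictionary_identity`, the EXACT PRIME SIDE
  (`primeSide_identity`, registered hook `typeData_primeSide`): the prime-tuple sums over the shifts of a box
  in the cell are the type-class moving moments evaluated by `TypeClassMoments`;
* `coprimePairs` evaluated by the coprime-density identity (W5) of `SingularWeightFacts` (`coprimePairs_mul_eq`).
-/

noncomputable section

open scoped BigOperators Classical ArithmeticFunction.vonMangoldt
open Finset Literature.NumberTheory.Sieve
open Summit.Parity.GeneralizedHardyLittlewood.Cruxes.RelativeDimOne.GallagherBackwards (classPsi)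
open Summit.Parity.GeneralizedHardyLittlewood.Cruxes.RelativeDimOne.GallagherBackwardsSplit

namespace Summit.Parity.GeneralizedHardyLittlewood.Cruxes.RelativeDimOne.TypeSplit

namespace TypeDataProof

variable {t : ℕ}

/-! ### Residues and incidence types -/

/-- `gcd(x, n) = gcd(y, n)` for `x ≡ y (mod n)`. -/
theorem int_gcd_congr {x y : ℤ} {n : ℕ} (h : x ≡ y [ZMOD n]) : Int.gcd x n = Int.gcd y n := by
  rw [← Int.gcd_emod x n, ← Int.gcd_emod y n, show x % (n : ℤ) = y % (n : ℤ) from h]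

/-- The incidence type modulo `q` only depends on the shift vector modulo `q`. -/
theorem incType_congr_mod {q : ℕ} (a : Fin t → ℤ) {b b' : Fin t → ℤ} (h : ∀ i, b i ≡ b' i [ZMOD q]) :
    incType q a b = incType q a b' := by
  unfold incType
  refine Prod.ext ?_ ?_
  · funext i
    refine Prod.ext rfl ?_
    dsimp only
    exact int_gcd_congr ((h i).of_dvd (Int.gcd_dvd_right _ _))
  · funext i j
    dsimp only
    exact int_gcd_congr (((h j).mul_left (a i)).sub ((h i).mul_left (a j)))

/-- Congruence modulo `q` implies congruence modulo every prime factor of `q`. -/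
theorem modEq_of_mem_primeFactors {q p : ℕ} (hp : p ∈ q.primeFactors) {x y : ℤ} (h : x ≡ y [ZMOD q]) :
    x ≡ y [ZMOD p] :=
  h.of_dvd (Int.natCast_dvd_natCast.2 (Nat.dvd_of_mem_primeFactors hp))

/-- A type-invariant spectrum is `q`-periodic in the shifts at every squarefree modulus `q`. -/
theorem typeInvariant_periodic {a : Fin t → ℤ} {e : ℕ → (Fin t → ℤ) → ℝ} (he : TypeInvariant a e)
    {q : ℕ} (hq : Squarefree q) {b b' : Fin t → ℤ} (h : ∀ i, b i ≡ b' i [ZMOD q]) : e q b = e q b' :=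
  he q hq b b' fun _ hp => incType_congr_mod a fun i => modEq_of_mem_primeFactors hp (h i)

/-- The residue vector `(b_i mod q)_i ∈ [0, q)^t` of an integer shift vector (written `fun i => (b i % q).toNat`
throughout) lies in `[0, q)^t`. -/
theorem natVec_mem {q : ℕ} (hq : 0 < q) (b : Fin t → ℤ) :
    (fun i => (b i % (q : ℤ)).toNat) ∈ Fintype.piFinset fun _ : Fin t => range q :=
  Fintype.mem_piFinset.2 fun i => mem_range.2 (toNat_emod_lt hq (b i))

/-- The residue vector is congruent to the vector. -/
theorem natVec_modEq {q : ℕ} (hq : 0 < q) (b : Fin t → ℤ) :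
    ∀ i, (((b i % (q : ℤ)).toNat : ℕ) : ℤ) ≡ b i [ZMOD q] := fun i => by
  rw [toNat_emod_cast hq]
  exact Int.mod_modEq _ _

/-- A vector with entries in `[0, q)` is its own residue vector. -/
theorem natVec_of_lt {q : ℕ} {v : Fin t → ℕ} (hv : ∀ i, v i < q) :
    (fun i => (((v i : ℕ) : ℤ) % (q : ℤ)).toNat) = v := by
  funext i
  have h1 : ((v i : ℕ) : ℤ) % (q : ℤ) = ((v i : ℕ) : ℤ) := by
    rw [← Int.natCast_mod, Nat.mod_eq_of_lt (hv i)]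
  rw [h1, Int.toNat_natCast]

/-- `(b mod q) = c` iff `b ≡ c (mod q)` coordinatewise, for `c ∈ [0, q)^t`. -/
theorem natVec_eq_iff {q : ℕ} (hq : 0 < q) (b : Fin t → ℤ) {c : Fin t → ℕ} (hc : ∀ i, c i < q) :
    (fun i => (b i % (q : ℤ)).toNat) = c ↔ ∀ i, b i ≡ (c i : ℤ) [ZMOD q] := by
  have hcmod : ∀ i, ((c i : ℕ) : ℤ) % (q : ℤ) = c i := fun i => by
    rw [← Int.natCast_mod, Nat.mod_eq_of_lt (hc i)]
  constructor
  · intro h i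
    have h1 : (((b i % (q : ℤ)).toNat : ℕ) : ℤ) = c i := by rw [← h]
    rw [toNat_emod_cast hq] at h1
    show b i % q = (c i : ℤ) % q
    rw [h1, hcmod]
  · intro h
    funext i
    have h1 : b i % (q : ℤ) = c i := by rw [show b i % q = (c i : ℤ) % q from h i, hcmod]
    rw [h1, Int.toNat_natCast]

/-! ### The type cell of the target -/

/-- The TYPE CELL of the target `b₀` at the modulus `P` is the set of integer shift vectors `b` with
`∀ p ∈ P.primeFactors, incType p a b = incType p a b₀` (incidence types agree with the target's at every prime
of `P`); we always write this predicate out. The cell is `P`-periodic. -/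
theorem isCell_congr {P : ℕ} (a b₀ : Fin t → ℤ) {b b' : Fin t → ℤ} (h : ∀ i, b i ≡ b' i [ZMOD P]) :
    (∀ p ∈ P.primeFactors, incType p a b = incType p a b₀) ↔
      (∀ p ∈ P.primeFactors, incType p a b' = incType p a b₀) := by
  have key : ∀ p ∈ P.primeFactors, incType p a b = incType p a b' := fun p hp =>
    incType_congr_mod a fun i => modEq_of_mem_primeFactors hp (h i)
  exact ⟨fun hc p hp => (key p hp).symm.trans (hc p hp), fun hc p hp => (key p hp).trans (hc p hp)⟩

/-- `typeCell P P a b₀` is the set of residue vectors modulo `P` of the cell. -/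
theorem mem_typeCell_self_iff {P : ℕ} (a b₀ : Fin t → ℤ) (v : Fin t → ℕ) :
    v ∈ typeCell P P a b₀ ↔
      (v ∈ Fintype.piFinset fun _ : Fin t => range P) ∧
        ∀ p ∈ P.primeFactors, incType p a (fun i => (v i : ℤ)) = incType p a b₀ := by
  unfold typeCell
  rw [mem_filter]
  exact and_congr Iff.rfl
    ⟨fun h p hp => h p hp (Nat.le_of_mem_primeFactors hp), fun h p hp _ => h p hp⟩

/-- The residue vector of a shift vector in the cell lies in `typeCell P P a b₀`. -/
theorem natVec_mem_typeCell {P : ℕ} (hP : 0 < P) (a b₀ : Fin t → ℤ) {b : Fin t → ℤ}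
    (hb : ∀ p ∈ P.primeFactors, incType p a b = incType p a b₀) :
    (fun i => (b i % (P : ℤ)).toNat) ∈ typeCell P P a b₀ :=
  (mem_typeCell_self_iff a b₀ _).2 ⟨natVec_mem hP b, (isCell_congr a b₀ (natVec_modEq hP b)).2 hb⟩

/-- The type cell of the target modulo `P` is non-empty (it contains `b₀ mod P`). -/
theorem typeCell_self_card_pos {P : ℕ} (hP : 0 < P) (a b₀ : Fin t → ℤ) :
    0 < (typeCell P P a b₀).card :=
  Finset.card_pos.2 ⟨_, natVec_mem_typeCell hP a b₀ (b := b₀) fun _ _ => rfl⟩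

/-- CELL DECOMPOSITION: a sum over the shift vectors of `B` in the cell is the sum over the residue classes
`c ∈ typeCell P P a b₀` of the sums over `b ∈ B`, `b ≡ c (P)`. -/
theorem sum_filter_isCell_eq {P : ℕ} (hP : 0 < P) (a b₀ : Fin t → ℤ) (B : Finset (Fin t → ℤ))
    (h : (Fin t → ℤ) → ℝ) :
    ∑ b ∈ B.filter (fun b => ∀ p ∈ P.primeFactors, incType p a b = incType p a b₀), h b =
      ∑ c ∈ typeCell P P a b₀, ∑ b ∈ B.filter (fun b => ∀ i, b i ≡ (c i : ℤ) [ZMOD P]), h b := by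
  rw [← Finset.sum_fiberwise_of_maps_to
      (s := B.filter (fun b => ∀ p ∈ P.primeFactors, incType p a b = incType p a b₀)) (t := typeCell P P a b₀)
      (g := fun b => fun i => (b i % (P : ℤ)).toNat) (fun b hb => natVec_mem_typeCell hP a b₀ (mem_filter.1 hb).2)]
  refine Finset.sum_congr rfl fun c hc => ?_
  have hc' := (mem_typeCell_self_iff a b₀ c).1 hc
  have hclt : ∀ i, c i < P := fun i => mem_range.1 (Fintype.mem_piFinset.1 hc'.1 i)
  refine Finset.sum_congr ?_ fun _ _ => rfl
  ext b
  simp only [mem_filter]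
  constructor
  · rintro ⟨⟨hbB, -⟩, hbc⟩
    exact ⟨hbB, (natVec_eq_iff hP b hclt).1 hbc⟩
  · rintro ⟨hbB, hbc⟩
    exact ⟨⟨hbB, (isCell_congr a b₀ hbc).2 hc'.2⟩, (natVec_eq_iff hP b hclt).2 hbc⟩

/-! ### The prime side -/

/-- PRIME SIDE, exact: the prime-tuple sums `Σ_{n<W} ∏_i Λ(a_i n + b_i)` summed over the shifts `b` of the box
`∏ [u_i, u_i + X_i]` lying in the cell are the type-class moving moments of `TypeClassMoments` at the modulus
`P` (the landed `dictionary_identity` on each residue class of the cell). -/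
theorem primeSide_identity {P : ℕ} (hP : 0 < P) (a b₀ u : Fin t → ℤ) (X : Fin t → ℕ) (W : ℕ)
    (hpos : ∀ i, ∀ n : ℕ, n < W → 1 ≤ a i * n + u i) :
    ∑ b ∈ (box u X).filter (fun b => ∀ p ∈ P.primeFactors, incType p a b = incType p a b₀),
        ∑ n ∈ range W, ∏ i, Λ ((a i * n + b i).toNat) =
      ∑ n ∈ range W, ∑ c ∈ typeCell P P a b₀,
        ∏ i, (classPsi (a i * n + u i + X i).toNat P (resid P (a i * n + c i))
              - classPsi (a i * n + u i - 1).toNat P (resid P (a i * n + c i))) := by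
  rw [sum_filter_isCell_eq hP, Finset.sum_comm]
  refine Finset.sum_congr rfl fun c _ => ?_
  exact dictionary_identity P hP a (fun i => (c i : ℤ)) u X W hpos

/-- `coprimePairs` evaluated by the coprime-density identity (W5):
`coprimePairs P a b₀ W · P^t = W · #cell · φ(P)^t · λ_P(a, b₀)`. -/
theorem coprimePairs_mul_eq
    (hW5 : ∀ (t q : ℕ), 1 ≤ q → Squarefree q → ∀ a b₀ : Fin t → ℤ, (∀ i, a i ≠ 0) → ∀ n : ℕ,
      ((((typeCell q q a b₀).filter (fun c => ∀ i, Int.gcd (a i * n + c i) q = 1)).card : ℕ) : ℝ)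
          * (q : ℝ) ^ t
        = ((typeCell q q a b₀).card : ℝ) * (Nat.totient q : ℝ) ^ t * localTypeFactor q a b₀)
    {P : ℕ} (hP : 1 ≤ P) (hPsq : Squarefree P) (a b₀ : Fin t → ℤ) (ha : ∀ i, a i ≠ 0) (W : ℕ) :
    (coprimePairs P a b₀ W : ℝ) * (P : ℝ) ^ t =
      W * (((typeCell P P a b₀).card : ℝ) * (Nat.totient P : ℝ) ^ t * localTypeFactor P a b₀) := by
  unfold coprimePairs
  push_cast
  rw [Finset.sum_mul, Finset.sum_congr rfl fun n _ => hW5 t P hP hPsq a b₀ ha n, Finset.sum_const,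
    card_range, nsmul_eq_mul]

/-- Registered hook (aux for `stub_typeData`): the exact prime side of the type-conditioned dictionary. -/
theorem typeData_primeSide : ∀ {t : ℕ} (P : ℕ), 0 < P → ∀ (a b₀ u : Fin t → ℤ) (X : Fin t → ℕ) (W : ℕ), (∀ i, ∀ n : ℕ, n < W → 1 ≤ a i * n + u i) → ∑ b ∈ (box u X).filter (fun b => ∀ p ∈ P.primeFactors, incType p a b = incType p a b₀), ∑ n ∈ Finset.range W, ∏ i, Λ ((a i * n + b i).toNat) = ∑ n ∈ Finset.range W, ∑ c ∈ typeCell P P a b₀, ∏ i, (classPsi (a i * n + u i + X i).toNat P (resid P (a i * n + c i)) - classPsi (a i * n + u i - 1).toNat P (resid P (a i * n + c i))) :=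
  fun _ hP a b₀ u X W hpos => primeSide_identity hP a b₀ u X W hpos

end TypeDataProof

end Summit.Parity.GeneralizedHardyLittlewood.Cruxes.RelativeDimOne.TypeSplit

end
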